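import Literature.NumberTheory.Transcendental.KZLogCalculusProofs
import Literature.NumberTheory.Transcendental.SemialgebraicMapsProofs

/-!
# `BetaCancellation` (stmt-KontsevichZagierPeriods-13633), line `divisor-slicing-transshipment` — objects for the one-bijection normal form (stub `stub_tameForm`)

Route-posited objects used by the proof of the stub `stub_tameForm` (one-bijection normal form of a
certificate of the Kontsevich–Zagier calculus, crux NOTES seat c6 "F13"):

* `MIso N σ ρ τ θ` — (a structure; statements assert `Nonempty (MIso …)`) a **finite piecewise `ℚ`-semialgebraic measure isomorphism, up to null sets**,
  between two finite families of *measured sets* in `ℝᴺ` (slot `i` carries the set `σ i` with density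
  `ρ i`, slot `k` the set `τ k` with density `θ k`): finitely many `ℚ`-semialgebraic pieces
  `P j ⊆ σ (src j)`, maps `Ψ j` (`ℚ`-semialgebraic, injective on `P j`, with a derivative `Ψ' j z`
  within `P j`, image inside `τ (tgt j)`) satisfying the measure-preservation identity
  `ρ (src j) z = θ (tgt j) (Ψ j z) · |det Ψ' j z|`, the pieces of one source slot pairwise a.e. disjoint
  and covering it a.e., the images inside one target slot pairwise a.e. disjoint and covering it a.e.
  For one slot on each side and densities `(1/(1+z₀²)) · A.integrand (tail z)` this is literally the
  data format of the conclusion of `stub_tameForm` (and of the hypothesis of `stub_pencilTransshipment`).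
* `stabSet h s`, `stabFun h f` — **stabilisation** of a set / a function from `ℝⁿ` to `ℝᴺ` (`n ≤ N`):
  `s × (0,1)ᴺ⁻ⁿ` (first `n` coordinates in `s`, the remaining ones in the open unit interval) and
  `f ∘ (projection to the first n coordinates)`.
* `liftSet N s`, `liftFun N f` — the same with the dimension bound as a junk-valued case split (so that
  families indexed by representations of varying dimension are non-dependent).
* `posSet r`, `negSet r` — the parts of the domain of an integral representation where the integrand
  is positive, resp. negative.
* `Shadow c` — (a structure; statements assert `Nonempty (Shadow c)`) **vanishing of the `K₀`-shadow** of a formal combination `c`: for some presentation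
  `c = ∑ᵢ [uᵢ] − ∑ⱼ [vⱼ]` and some common dimension `N`, the positive parts of the `uᵢ` together with
  the negative parts of the `vⱼ` (densities `fᵤ`, `−f_v`) are `MIso`-isomorphic, after stabilisation to
  `ℝᴺ`, to the positive parts of the `vⱼ` together with the negative parts of the `uᵢ`. (The common
  members of `u` and `v` are the "spectator" of the Grothendieck-group relation `[a] = [b] ⇔ a + c ≅ b + c`.)
  The theorem files prove that `Shadow` is an additive subgroup containing the four move sets of
  `KZ.relations`, hence contains `relations`.

No theorem here (definitions only — two data-carrying structures and six set/function constructors; the companion proof files are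
`TerasomaMultiplicationBetaCancellationStubTameForm*.lean`).

References: M. Kontsevich, D. Zagier, *Periods* (2001), §1.2 (the rules); crux NOTES c6 (F13).
-/

noncomputable section

-- `Summit.KontsevichZagierPeriods.KontsevichZagierPeriods.…` is the tree's mandated layout (single-conjunct summit).
set_option linter.dupNamespace false

namespace Summit.KontsevichZagierPeriods.KontsevichZagierPeriods.BetaCancellationDivisorSlicing

open MeasureTheory Set MvPolynomial
open Literature.NumberTheory.Transcendental
open Literature.NumberTheory.Transcendental.KZ
open Literature.ModelTheory.ExponentialFields (IsSemialgebraic isSemialgebraic_univ)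

/-- **Finite piecewise `ℚ`-semialgebraic measure isomorphism up to null sets** between two finite
families of measured sets in `ℝᴺ` (source slots `σ i` with densities `ρ i`, `i : ι`; target slots
`τ k` with densities `θ k`, `k : κ`), as a structure carrying the data: finitely many pieces
`P j ⊆ σ (src j)` (`ℚ`-semialgebraic) and maps `Ψ j` (`ℚ`-semialgebraic on `P j`, injective on `P j`,
with derivative `Ψ' j z` within `P j` at every `z ∈ P j`, `Ψ j '' P j ⊆ τ (tgt j)`) with the
measure-preservation identity `ρ (src j) z = θ (tgt j) (Ψ j z) * |det (Ψ' j z)|` on `P j`; pieces with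
the same source slot are pairwise a.e. disjoint and cover that slot a.e.; images with the same target
slot are pairwise a.e. disjoint and cover that slot a.e. (Slots are abstract summands of a disjoint
union: pieces of different slots may overlap as subsets of `ℝᴺ`.) Statements assert
`Nonempty (MIso N σ ρ τ θ)`. [folklore] -/
structure MIso (N : ℕ) {ι κ : Type*} (σ : ι → Set (Fin N → ℝ)) (ρ : ι → (Fin N → ℝ) → ℝ)
    (τ : κ → Set (Fin N → ℝ)) (θ : κ → (Fin N → ℝ) → ℝ) where
  /-- The number of pieces. -/
  J : ℕ
  /-- The source slot of each piece. -/
  src : Fin J → ι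
  /-- The target slot of each piece. -/
  tgt : Fin J → κ
  /-- The pieces. -/
  P : Fin J → Set (Fin N → ℝ)
  /-- The maps. -/
  Ψ : Fin J → (Fin N → ℝ) → (Fin N → ℝ)
  /-- The derivatives of the maps within the pieces. -/
  Ψ' : Fin J → (Fin N → ℝ) → ((Fin N → ℝ) →L[ℝ] (Fin N → ℝ))
  /-- Each piece is `ℚ`-semialgebraic, lies in its source slot, its map is `ℚ`-semialgebraic,
  injective and differentiable within the piece, maps it into the target slot, and preserves the
  measures `ρ dz`, `θ dz`. -/
  piece : ∀ j, IsSemialgebraic ℚ (P j) ∧ P j ⊆ σ (src j) ∧ IsSemialgebraicMapOn ℚ (P j) (Ψ j) ∧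
    Set.InjOn (Ψ j) (P j) ∧ (∀ z ∈ P j, HasFDerivWithinAt (Ψ j) (Ψ' j z) (P j) z) ∧
    Ψ j '' P j ⊆ τ (tgt j) ∧ ∀ z ∈ P j, ρ (src j) z = θ (tgt j) (Ψ j z) * |(Ψ' j z).det|
  /-- Pieces of one source slot are pairwise a.e. disjoint. -/
  disjoint_src : ∀ j j', j ≠ j' → src j = src j' → volume (P j ∩ P j') = 0
  /-- Images inside one target slot are pairwise a.e. disjoint. -/
  disjoint_tgt : ∀ j j', j ≠ j' → tgt j = tgt j' → volume (Ψ j '' P j ∩ Ψ j' '' P j') = 0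
  /-- The pieces of a source slot cover it a.e. -/
  cover_src : ∀ i, volume (σ i \ ⋃ (j) (_ : src j = i), P j) = 0
  /-- The images inside a target slot cover it a.e. -/
  cover_tgt : ∀ k, volume (τ k \ ⋃ (j) (_ : tgt j = k), Ψ j '' P j) = 0

/-- **Stabilisation of a set** `s ⊆ ℝⁿ` to `ℝᴺ` (`n ≤ N`): the first `n` coordinates lie in `s`,
the remaining `N − n` coordinates in the open unit interval, i.e. `s × (0,1)ᴺ⁻ⁿ`. [folklore] -/
def stabSet {n N : ℕ} (h : n ≤ N) (s : Set (Fin n → ℝ)) : Set (Fin N → ℝ) :=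
  {z | (fun i => z (Fin.castLE h i)) ∈ s ∧ ∀ i : Fin N, n ≤ (i : ℕ) → z i ∈ Set.Ioo (0 : ℝ) 1}

/-- **Stabilisation of a function** from `ℝⁿ` to `ℝᴺ` (`n ≤ N`): compose with the projection to
the first `n` coordinates. [folklore] -/
def stabFun {n N : ℕ} (h : n ≤ N) (f : (Fin n → ℝ) → ℝ) : (Fin N → ℝ) → ℝ :=
  fun z => f (fun i => z (Fin.castLE h i))

/-- **Lift of a set** `s ⊆ ℝⁿ` to `ℝᴺ`: the stabilisation `stabSet` when `n ≤ N`, and the junk value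
`∅` otherwise (only used with `n ≤ N`; the junk branch keeps the families of `Shadow` non-dependent).
[folklore] -/
def liftSet (N : ℕ) {n : ℕ} (s : Set (Fin n → ℝ)) : Set (Fin N → ℝ) :=
  if h : n ≤ N then stabSet h s else ∅

/-- **Lift of a function** from `ℝⁿ` to `ℝᴺ`: the stabilisation `stabFun` when `n ≤ N`, and the junk
value `0` otherwise (only used with `n ≤ N`). [folklore] -/
def liftFun (N : ℕ) {n : ℕ} (f : (Fin n → ℝ) → ℝ) : (Fin N → ℝ) → ℝ :=
  if h : n ≤ N then stabFun h f else 0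

/-- The positive part of the domain of an integral representation: `{x ∈ σ | 0 < f x}`. [folklore] -/
def posSet {n : ℕ} (r : IntegralRep n) : Set (Fin n → ℝ) := {x | x ∈ r.domain ∧ 0 < r.integrand x}

/-- The negative part of the domain of an integral representation: `{x ∈ σ | f x < 0}`. [folklore] -/
def negSet {n : ℕ} (r : IntegralRep n) : Set (Fin n → ℝ) := {x | x ∈ r.domain ∧ r.integrand x < 0}

/-- **Vanishing of the `K₀`-shadow** of a formal combination `c` of integral representations, as a
structure carrying the data: a presentation `c = ∑ᵢ [uᵢ] − ∑ⱼ [vⱼ]` and a common dimension `N` (at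
least every dimension involved) such that, after stabilisation to `ℝᴺ`, the family of measured sets
"positive parts of the `uᵢ` (density `fᵤᵢ`), negative parts of the `vⱼ` (density `−f_vⱼ`)" is
`MIso`-isomorphic to the family "positive parts of the `vⱼ`, negative parts of the `uᵢ`". This is the
relation `[a] = [b]` of the Grothendieck group of the monoid of positive measured `ℚ`-semialgebraic
sets under disjoint union (the members common to `u` and `v` being the spectator `c` of
`a + c ≅ b + c`), transported to `FormalRep` along `[σ, f] ↦ [σ ∩ {f>0}, f] − [σ ∩ {f<0}, −f]`.
Statements assert `Nonempty (Shadow c)`. [folklore] -/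
structure Shadow (c : FormalRep) where
  /-- Number of positively presented representations. -/
  a : ℕ
  /-- Number of negatively presented representations. -/
  b : ℕ
  /-- The positively presented representations. -/
  u : Fin a → Σ n, IntegralRep n
  /-- The negatively presented representations. -/
  v : Fin b → Σ n, IntegralRep n
  /-- The presentation `c = ∑ᵢ [uᵢ] − ∑ⱼ [vⱼ]`. -/
  eq : c = ∑ i, of (u i).2 - ∑ j, of (v j).2
  /-- The common dimension. -/
  N : ℕ
  /-- The common dimension bounds the dimensions of the `uᵢ`. -/
  hu : ∀ i, (u i).1 ≤ N
  /-- The common dimension bounds the dimensions of the `vⱼ`. -/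
  hv : ∀ j, (v j).1 ≤ N
  /-- The measure isomorphism `u⁺ ⊔ v⁻ ≅ v⁺ ⊔ u⁻` in `ℝᴺ`. -/
  iso : MIso N
    (Sum.elim (fun i => liftSet N (posSet (u i).2)) (fun j => liftSet N (negSet (v j).2)))
    (Sum.elim (fun i => liftFun N (u i).2.integrand) (fun j => liftFun N (-(v j).2.integrand)))
    (Sum.elim (fun j => liftSet N (posSet (v j).2)) (fun i => liftSet N (negSet (u i).2)))
    (Sum.elim (fun j => liftFun N (v j).2.integrand) (fun i => liftFun N (-(u i).2.integrand)))

variable {n N : ℕ}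

/-! ### Unfolding -/

/-- Membership in a stabilised set. [folklore] -/
theorem mem_stabSet {h : n ≤ N} {s : Set (Fin n → ℝ)} {z : Fin N → ℝ} :
    z ∈ stabSet h s ↔ (fun i => z (Fin.castLE h i)) ∈ s ∧
      ∀ i : Fin N, n ≤ (i : ℕ) → z i ∈ Set.Ioo (0 : ℝ) 1 :=
  Iff.rfl

/-- Unfolding a stabilised function. [folklore] -/
@[simp] theorem stabFun_apply (h : n ≤ N) (f : (Fin n → ℝ) → ℝ) (z : Fin N → ℝ) :
    stabFun h f z = f (fun i => z (Fin.castLE h i)) :=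
  rfl

/-- `liftSet` is `stabSet` within the dimension bound. [folklore] -/
theorem liftSet_eq (h : n ≤ N) (s : Set (Fin n → ℝ)) : liftSet N s = stabSet h s :=
  dif_pos h

/-- `liftFun` is `stabFun` within the dimension bound. [folklore] -/
theorem liftFun_eq (h : n ≤ N) (f : (Fin n → ℝ) → ℝ) : liftFun N f = stabFun h f :=
  dif_pos h

/-- Stabilisation to the same dimension does nothing to sets. [folklore] -/
@[simp] theorem stabSet_rfl (s : Set (Fin n → ℝ)) : stabSet le_rfl s = s := by
  ext z
  simp only [mem_stabSet, Fin.castLE_rfl, id_eq]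
  exact ⟨fun h => h.1, fun h => ⟨h, fun i hi => absurd i.is_lt (not_lt.mpr hi)⟩⟩

/-- Stabilisation to the same dimension does nothing to functions. [folklore] -/
@[simp] theorem stabFun_rfl (f : (Fin n → ℝ) → ℝ) : stabFun le_rfl f = f := by
  funext z
  simp

/-- Stabilisations of sets compose. [folklore] -/
theorem stabSet_stabSet {N' : ℕ} (h : n ≤ N) (h' : N ≤ N') (s : Set (Fin n → ℝ)) :
    stabSet h' (stabSet h s) = stabSet (h.trans h') s := by
  ext z
  simp only [mem_stabSet, Fin.castLE_castLE]
  constructor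
  · rintro ⟨⟨hs, hpad⟩, hpad'⟩
    refine ⟨hs, fun i hi => ?_⟩
    by_cases hiN : (i : ℕ) < N
    · exact hpad ⟨i, hiN⟩ hi
    · exact hpad' i (not_lt.mp hiN)
  · rintro ⟨hs, hpad⟩
    exact ⟨⟨hs, fun i hi => hpad (Fin.castLE h' i) hi⟩, fun i hi => hpad i (h.trans hi)⟩

/-- Stabilisations of functions compose. [folklore] -/
theorem stabFun_stabFun {N' : ℕ} (h : n ≤ N) (h' : N ≤ N') (f : (Fin n → ℝ) → ℝ) :
    stabFun h' (stabFun h f) = stabFun (h.trans h') f := by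
  funext z
  simp [Fin.castLE_castLE]

/-- A stabilised set lies in the cylinder over the original set. [folklore] -/
theorem stabSet_subset_setOf (h : n ≤ N) (s : Set (Fin n → ℝ)) :
    stabSet h s ⊆ {z | (fun i => z (Fin.castLE h i)) ∈ s} := fun _ hz => hz.1

/-- Stabilisation of sets is monotone. [folklore] -/
theorem stabSet_mono (h : n ≤ N) {s t : Set (Fin n → ℝ)} (hst : s ⊆ t) : stabSet h s ⊆ stabSet h t :=
  fun _ hz => ⟨hst hz.1, hz.2⟩

/-- Stabilisation commutes with intersections. [folklore] -/
theorem stabSet_inter (h : n ≤ N) (s t : Set (Fin n → ℝ)) :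
    stabSet h (s ∩ t) = stabSet h s ∩ stabSet h t := by
  ext z
  simp only [mem_stabSet, mem_inter_iff]
  tauto

/-- Stabilisation commutes with set difference. [folklore] -/
theorem stabSet_diff (h : n ≤ N) (s t : Set (Fin n → ℝ)) :
    stabSet h (s \ t) = stabSet h s \ stabSet h t := by
  ext z
  constructor
  · rintro ⟨⟨hs, ht⟩, hpad⟩
    exact ⟨⟨hs, hpad⟩, fun h' => ht h'.1⟩
  · rintro ⟨⟨hs, hpad⟩, h2⟩
    exact ⟨⟨hs, fun ht => h2 ⟨ht, hpad⟩⟩, hpad⟩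

/-- Stabilisation commutes with separation by a condition on the first coordinates. [folklore] -/
theorem stabSet_sep (h : n ≤ N) (s : Set (Fin n → ℝ)) (p : (Fin n → ℝ) → Prop) :
    stabSet h {x | x ∈ s ∧ p x} = {z | z ∈ stabSet h s ∧ p (fun i => z (Fin.castLE h i))} := by
  ext z
  simp only [mem_stabSet, mem_setOf_eq]
  tauto

/-! ### Semialgebraicity -/

/-- The padding condition `∀ i ≥ n, 0 < zᵢ < 1` is `ℚ`-semialgebraic. [cite: BCR1998, §2.1] -/
theorem isSemialgebraic_setOf_pad (n N : ℕ) :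
    IsSemialgebraic ℚ {z : Fin N → ℝ | ∀ i : Fin N, n ≤ (i : ℕ) → z i ∈ Set.Ioo (0 : ℝ) 1} := by
  classical
  have h : {z : Fin N → ℝ | ∀ i : Fin N, n ≤ (i : ℕ) → z i ∈ Set.Ioo (0 : ℝ) 1} =
      ⋂ i ∈ (Finset.univ.filter fun i : Fin N => n ≤ (i : ℕ)),
        ({z : Fin N → ℝ | aeval z (0 : MvPolynomial (Fin N) ℚ) < aeval z (X i : MvPolynomial (Fin N) ℚ)} ∩
          {z : Fin N → ℝ | aeval z (X i : MvPolynomial (Fin N) ℚ) <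
            aeval z (1 : MvPolynomial (Fin N) ℚ)}) := by
    ext z
    simp only [mem_setOf_eq, mem_iInter, Finset.mem_filter, Finset.mem_univ, true_and,
      mem_inter_iff, map_zero, aeval_X, map_one, mem_Ioo]
  rw [h]
  exact Literature.ModelTheory.ExponentialFields.IsSemialgebraic.biInter _ _ fun i _ =>
    (Literature.ModelTheory.ExponentialFields.isSemialgebraic_setOf_eval_lt _ _).inter
      (Literature.ModelTheory.ExponentialFields.isSemialgebraic_setOf_eval_lt _ _)

/-- A stabilised `ℚ`-semialgebraic set is `ℚ`-semialgebraic. [cite: BCR1998, §2.1] -/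
theorem isSemialgebraic_stabSet (h : n ≤ N) {s : Set (Fin n → ℝ)} (hs : IsSemialgebraic ℚ s) :
    IsSemialgebraic ℚ (stabSet h s) :=
  (hs.preimage_comp (Fin.castLE h)).inter (isSemialgebraic_setOf_pad n N)

/-- The cylinder over a `ℚ`-semialgebraic set is `ℚ`-semialgebraic. [cite: BCR1998, §2.1] -/
theorem isSemialgebraic_setOf_castLE_mem (h : n ≤ N) {s : Set (Fin n → ℝ)}
    (hs : IsSemialgebraic ℚ s) : IsSemialgebraic ℚ {z : Fin N → ℝ | (fun i => z (Fin.castLE h i)) ∈ s} :=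
  hs.preimage_comp (Fin.castLE h)

/-- A function of the first `n` coordinates which is `ℚ`-semialgebraic on `s` is `ℚ`-semialgebraic
on every `ℚ`-semialgebraic subset of the cylinder over `s`. [cite: BCR1998, Prop. 2.2.6] -/
theorem isSemialgebraicFunOn_stabFun_of_subset (h : n ≤ N) {s : Set (Fin n → ℝ)}
    {f : (Fin n → ℝ) → ℝ} (hf : IsSemialgebraicFunOn ℚ s f) {B : Set (Fin N → ℝ)}
    (hB : IsSemialgebraic ℚ B) (hBs : B ⊆ {z | (fun i => z (Fin.castLE h i)) ∈ s}) :
    IsSemialgebraicFunOn ℚ B (stabFun h f) := by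
  -- the coordinate map `θ : Fin (n + 1) → Fin (N + 1)`, `castSucc i ↦ castSucc (castLE h i)`,
  -- `last ↦ last`
  set θ : Fin (n + 1) → Fin (N + 1) :=
    Fin.snoc (fun i : Fin n => Fin.castSucc (Fin.castLE h i)) (Fin.last N) with hθ
  have hg : IsSemialgebraic ℚ {v : Fin (n + 1) → ℝ | Fin.init v ∈ s ∧ v (Fin.last n) = f (Fin.init v)} :=
    isSemialgebraicFunOn_iff.mp hf
  have hpre := hg.preimage_comp θ
  rw [isSemialgebraicFunOn_iff]
  have hinit : ∀ w : Fin (N + 1) → ℝ, Fin.init (w ∘ θ) = fun i => Fin.init w (Fin.castLE h i) := by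
    intro w
    funext i
    simp [hθ, Fin.init]
  have hlast : ∀ w : Fin (N + 1) → ℝ, (w ∘ θ) (Fin.last n) = w (Fin.last N) := by
    intro w
    simp [hθ]
  convert (hB.preimage_comp Fin.castSucc).inter hpre using 1
  ext w
  simp only [mem_setOf_eq, mem_inter_iff, mem_preimage, stabFun_apply, hinit, hlast]
  constructor
  · rintro ⟨hw, hwf⟩
    exact ⟨hw, hBs hw, hwf⟩
  · rintro ⟨hw, -, hwf⟩
    exact ⟨hw, hwf⟩

/-- A stabilised `ℚ`-semialgebraic function is `ℚ`-semialgebraic on the stabilised set.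
[cite: BCR1998, Prop. 2.2.6] -/
theorem isSemialgebraicFunOn_stabFun (h : n ≤ N) {s : Set (Fin n → ℝ)} {f : (Fin n → ℝ) → ℝ}
    (hs : IsSemialgebraic ℚ s) (hf : IsSemialgebraicFunOn ℚ s f) :
    IsSemialgebraicFunOn ℚ (stabSet h s) (stabFun h f) :=
  isSemialgebraicFunOn_stabFun_of_subset h hf (isSemialgebraic_stabSet h hs) (stabSet_subset_setOf h s)

/-- A stabilised set is measurable when the original set is `ℚ`-semialgebraic. [cite: BCR1998, §2.1] -/
theorem measurableSet_stabSet (h : n ≤ N) {s : Set (Fin n → ℝ)} (hs : IsSemialgebraic ℚ s) :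
    MeasurableSet (stabSet h s) :=
  Literature.ModelTheory.ExponentialFields.IsSemialgebraic.measurableSet_holds
    (isSemialgebraic_stabSet h hs)

/-! ### Null sets -/

/-- The cylinder in `ℝᴺ` over a null set of `ℝⁿ` (`n ≤ N`) is null (induction on `N`, one
coordinate at a time by `KZ.volume_setOf_init_mem_eq_zero`). [folklore] -/
theorem volume_setOf_castLE_mem_eq_zero (h : n ≤ N) {s : Set (Fin n → ℝ)} (hs : volume s = 0) :
    volume {z : Fin N → ℝ | (fun i => z (Fin.castLE h i)) ∈ s} = 0 := by
  induction N, h using Nat.le_induction with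
  | base =>
    have : {z : Fin n → ℝ | (fun i => z (Fin.castLE (le_refl n) i)) ∈ s} = s := by
      ext z
      simp only [mem_setOf_eq, Fin.castLE_rfl, id_eq]
    rw [this]
    exact hs
  | succ N h ih =>
    have hsub : {z : Fin (N + 1) → ℝ | (fun i => z (Fin.castLE (h.trans N.le_succ) i)) ∈ s} ⊆
        {z | Fin.init z ∈ {y : Fin N → ℝ | (fun i => y (Fin.castLE h i)) ∈ s}} := by
      intro z hz
      exact hz
    exact measure_mono_null hsub (volume_setOf_init_mem_eq_zero ih)

/-- Stabilisation preserves null sets. [folklore] -/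
theorem volume_stabSet_eq_zero (h : n ≤ N) {s : Set (Fin n → ℝ)} (hs : volume s = 0) :
    volume (stabSet h s) = 0 :=
  measure_mono_null (stabSet_subset_setOf h s) (volume_setOf_castLE_mem_eq_zero h hs)

/-! ### Headline -/

/-- Registered helper goal of the stub `stub_tameForm` (file of definitions): stabilised sets and
functions are `ℚ`-semialgebraic. [cite: BCR1998, Prop. 2.2.6] -/
theorem tameForm_aux_stabFun : ∀ {n N : ℕ} (h : n ≤ N) {s : Set (Fin n → ℝ)} {f : (Fin n → ℝ) → ℝ}, IsSemialgebraic ℚ s → IsSemialgebraicFunOn ℚ s f → IsSemialgebraicFunOn ℚ (stabSet h s) (stabFun h f) ∧ IsSemialgebraic ℚ (stabSet h s) :=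
  fun h _ _ hs hf => ⟨isSemialgebraicFunOn_stabFun h hs hf, isSemialgebraic_stabSet h hs⟩

end Summit.KontsevichZagierPeriods.KontsevichZagierPeriods.BetaCancellationDivisorSlicing

end
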